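import Summits.QuantumFields.YangMills.Theorems.FlatTubeReductionDressedFixedBetaNear
import Summits.QuantumFields.YangMills.Theorems.FlatTubeReductionDressedHTFixedBeta
import HarnessLib

/-!
# THE DRESSED (B-T) BRICK AT FIXED `β` WITH THE NEAR-PAIR RATE: `…DressedHTFixedBeta.dressed_hT_fixed_beta` verbatim with `…DressedFixedBetaNear.dressed_fixed_beta_estimate_near` as the kernel
# comparison (`κ₀ = ξ + 120η_s²` with the differenced magnetic remainder in `η_s`)
# (route `FlatTubeReduction`, crux K1 `NearFlatRatioLaw` stmt-QuantumFields-24720; seat `ym-line-ftr-p1` g16; rate twin «ratepack»; R2b1 RECORD rung — no summit statement is proved here)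

WHY (NOTES g16 «NP-L»).  Fixed-`β` end of the near-pair-Lipschitz repair: with this file the dressed (B-T) brick `|tubeForm β (boFunAd φ (n·Ω)) − c·Q(φW)| ≤ κ·c·(Q(φW) + λ₀‖φ‖²)` holds at
fixed `β` with a relative rate whose `t`-dependence is `β·N_pl·(58752t³ + 1401138t⁴ + 10⁷αt²)` — `o(λ_b)` in `η_s` (so `o(λ_b²)` in `κ₀`) for every fibre radius `t = K·β^{-1/2}`, `K ≤ polylog`
(`…RateKappaNear`).  What remains for the eventual statement at such radii is schedule bookkeeping (`coreEps/coreEta ≤ 1`, margins, tail budget with `βR² ≤ C_K log β`).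
* ★★★ `dressed_hT_fixed_beta_near`.
HONEST FRAMING: bookkeeping of landed bricks for a stub of the CONDITIONAL reduction route R2b1; femto rung R2b1 (RECORD label); not infinite volume, not a gap, not Clay.  No defs, no named
facts, no `sorry`.
-/

set_option autoImplicit false

noncomputable section

open MeasureTheory Filter Topology Real
open scoped BigOperators Matrix Quaternion
open Literature.MathematicalPhysics.QuantumFieldTheory
open Literature.MathematicalPhysics.QuantumLattice

namespace Summit.QuantumFields.YangMills.Theorems.FemtoTransferGap.TwoLattice.ConstTube

open Summit.QuantumFields.YangMills.Theorems.FemtoTransferGap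
open Summit.QuantumFields.YangMills.Theorems.FemtoTransferGap.TwoLattice
open Summit.QuantumFields.YangMills.Theorems.FemtoTransferGap.TwoLattice.Avg
open Summit.QuantumFields.YangMills.Theorems.FemtoTransferGap.TwoLattice.Stiff (LinkSpace)
open Summit.QuantumFields.YangMills.Theorems.FemtoTransferGap.TwoLattice.Cov

variable {L : ℕ} [NeZero L]

set_option maxHeartbeats 3200000 in
-- as in `…DressedHTFixedBeta` (1.6M there): one long assembly with many opaque abbreviations and a longer rate polynomial; the default budget is exceeded.
/-- ★★★ **THE DRESSED (B-T) BRICK AT FIXED `β`, NEAR-PAIR RATE** (`η_s` of `…SymmetricCorePairNear`, `α ≤ 1/30` added; otherwise (see the module docstring): under the smallness hypotheses of `dressed_fixed_beta_estimate`, the window facts of the profile/dressing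
package at this `β` (`n` measurable, `0 ≤ n ≤ 1`, gauge invariant; `W` physical, `0 ≤ W ≤ C_W`; on the window `|W² − F/F(1)/m̃| ≤ ε_W ≤ ¼`, `n²m̃ = ½`, `|W² − 1| ≤ ½`, `|m̃ − 1| ≤ ½`),
`𝔉(1,1) > 0` and the tail budget `τ ≤ κ₂·btC·λ₀(1,L³β)`: for every bounded measurable gauge-invariant `φ` supported in the window,
`|tubeForm β (boFunAd φ (n·Ω)) − c·Q(φW)| ≤ ((κ₀(1+5ε_W)+5ε_W)(1+C_W²) + 2κ₂)·c·(Q(φW) + λ₀‖φ‖²)`, `c = F(1,1)/2/fpZ ε`. [cite: Luscher1983, §3] -/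
theorem dressed_hT_fixed_beta_near {β : ℝ} (hβ : 0 ≤ β) {Ω : LinkSpace L → ℝ} (hΩm : Measurable Ω) (hΩ1 : ∀ x, |Ω x| ≤ 1) (hΩ0 : ∀ x, 0 ≤ Ω x)
    (hΩinv : ∀ (g : SU2) (x : LinkSpace L), Ω (adL L g x) = Ω x) {δ α t R R₁ ε P₀ : ℝ}
    (hΩt : ∀ v : Edge 3 L → Fin 3 → ℝ, Ω (linkEmbed L v) ≠ 0 → v ∈ capBalancedSet L ∧ (∀ (e : Edge 3 L) (c : Fin 3), |v e c| ≤ t) ∧ ‖linkEmbed L v‖ ≤ R)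
    (hδ2 : δ ≤ 1 / 2) (hα0 : 0 ≤ α) (hα1 : α ≤ 1) (hα30 : α ≤ 1 / 30) (hε0 : 0 < ε) (ht0 : 0 ≤ t)
    (htT : t ≤ 9 * L * R₁ + ε) (hT : 9 * L * R₁ + ε ≤ 1 / 30) (hσ : (L : ℝ) ^ 3 * (12 * δ ^ 4) < 2)
    (hεsum : coreEps1 L β δ (9 * L * R₁ + ε) R + coreEps2 L β δ (9 * L * R₁ + ε) R ((L : ℝ) ^ 3 * (12 * δ ^ 4)) ≤ 1)
    (hηd : coreEta L β δ α (9 * L * R₁ + ε) R (ε * Fintype.card (Site 3 L)) ((L : ℝ) ^ 3 * (12 * δ ^ 4)) ≤ 1)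
    (hηs : β * ((Fintype.card (Edge 3 L) : ℝ) * (558 * α ^ 2 * (9 * L * R₁ + ε) ^ 2 + 192 * α * (9 * L * R₁ + ε) ^ 2) + 216 * α * δ * (ε * Fintype.card (Site 3 L))) +
        β / 2 * (100 * ((L : ℝ) ^ 3 * (12 * δ ^ 4)) * (Fintype.card (Plaquette 3 L × Fin 3) : ℝ) * R ^ 2 + 10080 * α * (Fintype.card (Plaquette 3 L × Fin 3) : ℝ) * R ^ 2 +
          (Fintype.card (Plaquette 3 L) : ℝ) * (58752 * t ^ 3 + 1401138 * t ^ 4 + 10000000 * α * t ^ 2)) ≤ 1)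
    (hLa : 18 * L * (Real.sqrt 2 * R + δ) ≤ 1 / 2)
    (hm₁ : 0 ≤ R₁ / 2 - 2 * (Real.sqrt 2 * R + δ) * ε - (2 * Real.sqrt 2 * R + α)) (hm₂ : 0 ≤ 1 / (3 * L) - 4 * (Real.sqrt 2 * R + δ) - (2 * Real.sqrt 2 * R + α))
    (hP : 3 * L * P₀ < 1) (hP0 : 0 ≤ P₀ - 4 * (Real.sqrt 2 * R + δ) - (2 * Real.sqrt 2 * R + 2 * δ))
    (hJ : 2 * ε * Fintype.card (Site 3 L) * δ + 2 * R ^ 2 + 2 * Real.sqrt 2 * Fintype.card (Site 3 L) * (9 * L * P₀ + ε) * R ≤ Fintype.card (Site 3 L) * (1 - 3 * L * P₀) * α)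
    -- the normaliser and the dressing at this `β`
    {n W m : GaugeConfig 3 1 SU2 → ℝ} (hnm : Measurable n) (hn01 : ∀ u, 0 ≤ n u ∧ n u ≤ 1)
    (hng : ∀ (g : Site 3 1 → SU2) (u : GaugeConfig 3 1 SU2), n (gaugeTransform g u) = n u)
    (hWphys : IsPhys W) (hW0 : ∀ u, 0 ≤ W u) {CW : ℝ} (hWC : ∀ u, |W u| ≤ CW) {εW : ℝ} (hεW0 : 0 ≤ εW) (hεW4 : εW ≤ 1 / 4)
    (hwin : ∀ u : GaugeConfig 3 1 SU2, orbitDist u < δ →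
      |W u ^ 2 - fpBOKernel L β Ω (fpWeight L ε) u u / transferKernel su2Rep ((L : ℝ) ^ 3 * β) u u /
          (fpBOKernel L β Ω (fpWeight L ε) 1 1 / transferKernel su2Rep ((L : ℝ) ^ 3 * β) (1 : GaugeConfig 3 1 SU2) 1) / m u| ≤ εW ∧
        n u ^ 2 * m u = 1 / 2 ∧ |W u ^ 2 - 1| ≤ 1 / 2 ∧ |m u - 1| ≤ 1 / 2)
    (ha0 : 0 < fpBOKernel L β Ω (fpWeight L ε) 1 1) {κ₂ : ℝ} (hκ₂ : 0 ≤ κ₂)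
    (hτ : Real.exp (6 * ((L : ℝ) ^ 3 * β)) *
        (Real.exp (3 * ((L : ℝ) ^ 3 * β) * α ^ 2) * (Real.exp (-(β * btMnt L δ α R R₁ ε) + β * stepActionErr (L := L) t ((L : ℝ) ^ 3 * (12 * δ ^ 4))) *
              (∫ v, Ω (linkEmbed L v) ∂orthoTransverse L) ^ 2) +
          2 * Real.sqrt (Real.exp (-(β * btMnt L δ α R R₁ ε) + β * stepActionErr (L := L) t ((L : ℝ) ^ 3 * (12 * δ ^ 4))) * (∫ v, Ω (linkEmbed L v) ∂orthoTransverse L) ^ 2) *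
            Real.sqrt (9 * btC L β Ω ε R₁ + Real.exp (-(β * btMnt L δ α R R₁ ε) + β * stepActionErr (L := L) t ((L : ℝ) ^ 3 * (12 * δ ^ 4))) * (∫ v, Ω (linkEmbed L v) ∂orthoTransverse L) ^ 2) +
          Real.exp (-(β * btMfar L δ α R ε P₀)) * (∫ v, Ω (linkEmbed L v) ∂orthoTransverse L) ^ 2 +
          (9 * btC L β Ω ε R₁ + Real.exp (-(β * btMnt L δ α R R₁ ε) + β * stepActionErr (L := L) t ((L : ℝ) ^ 3 * (12 * δ ^ 4))) * (∫ v, Ω (linkEmbed L v) ∂orthoTransverse L) ^ 2) *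
            Real.exp (-((L : ℝ) ^ 3 * β * α ^ 2))) ≤
      κ₂ * btC L β Ω ε R₁ * levelValue su2Rep 1 ((L : ℝ) ^ 3 * β) 0)
    (φ : GaugeConfig 3 1 SU2 → ℝ) (hφm : Measurable φ) {Cφ : ℝ} (hCφ : ∀ u, |φ u| ≤ Cφ)
    (hφg : ∀ (g : Site 3 1 → SU2) (u : GaugeConfig 3 1 SU2), φ (gaugeTransform g u) = φ u) (hsupp : ∀ u, φ u ≠ 0 → orbitDist u < δ) :
    |tubeForm β (RateTube.boFunAd L φ (fun u x => n u * Ω x)) -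
        fpBOKernel L β Ω (fpWeight L ε) 1 1 / transferKernel su2Rep ((L : ℝ) ^ 3 * β) (1 : GaugeConfig 3 1 SU2) 1 / 2 / fpZ ε *
          qform su2Rep ((L : ℝ) ^ 3 * β) (fun u => φ u * W u) (fun u => φ u * W u)| ≤
      (((β * (Fintype.card (Edge 3 L) : ℝ) * α ^ 2 * (6 * t + 2 * (9 * L * R₁ + ε)) ^ 2 +
          120 * (β * ((Fintype.card (Edge 3 L) : ℝ) * (558 * α ^ 2 * (9 * L * R₁ + ε) ^ 2 + 192 * α * (9 * L * R₁ + ε) ^ 2) + 216 * α * δ * (ε * Fintype.card (Site 3 L))) +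
            β / 2 * (100 * ((L : ℝ) ^ 3 * (12 * δ ^ 4)) * (Fintype.card (Plaquette 3 L × Fin 3) : ℝ) * R ^ 2 + 10080 * α * (Fintype.card (Plaquette 3 L × Fin 3) : ℝ) * R ^ 2 +
              (Fintype.card (Plaquette 3 L) : ℝ) * (58752 * t ^ 3 + 1401138 * t ^ 4 + 10000000 * α * t ^ 2))) ^ 2) * (1 + 5 * εW) + 5 * εW) * (1 + CW ^ 2) + 2 * κ₂) *
        (fpBOKernel L β Ω (fpWeight L ε) 1 1 / transferKernel su2Rep ((L : ℝ) ^ 3 * β) (1 : GaugeConfig 3 1 SU2) 1 / 2 / fpZ ε) *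
        (qform su2Rep ((L : ℝ) ^ 3 * β) (fun u => φ u * W u) (fun u => φ u * W u) + levelValue su2Rep 1 ((L : ℝ) ^ 3 * β) 0 * l2 φ φ) := by
  have hB0 : (0 : ℝ) ≤ (L : ℝ) ^ 3 * β := by positivity
  have hZ0 : 0 < fpZ ε := fpZ_pos hε0
  have hCW0 : 0 ≤ CW := (abs_nonneg _).trans (hWC 1)
  have hCφ0 : 0 ≤ Cφ := (abs_nonneg _).trans (hCφ 1)
  have hWm : Measurable W := hWphys.measurable
  have hfw := measurable_fpWeight L ε
  have hfw1 := abs_fpWeight_le L ε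
  have hF0 : ∀ u : GaugeConfig 3 1 SU2, 0 ≤ fpBOKernel L β Ω (fpWeight L ε) u u / transferKernel su2Rep ((L : ℝ) ^ 3 * β) u u := fun u =>
    div_nonneg (fpBOKernel_nonneg β hΩm hΩ1 hΩ0 hfw hfw1 (fun g => (fpWeight_mem_Icc L ε g).1) u u) (transferKernel_pos _ _ _ _).le
  -- opaque names: `a = F(1,1)`, `κ₀`, `τ`
  obtain ⟨a, ha⟩ : ∃ a : ℝ, a = fpBOKernel L β Ω (fpWeight L ε) 1 1 / transferKernel su2Rep ((L : ℝ) ^ 3 * β) (1 : GaugeConfig 3 1 SU2) 1 := ⟨_, rfl⟩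
  have ha_pos : 0 < a := by rw [ha]; exact div_pos ha0 (transferKernel_pos _ _ _ _)
  rw [← ha] at hwin ⊢
  obtain ⟨κ₀, hκ₀def⟩ : ∃ κ₀ : ℝ, κ₀ = β * (Fintype.card (Edge 3 L) : ℝ) * α ^ 2 * (6 * t + 2 * (9 * L * R₁ + ε)) ^ 2 +
          120 * (β * ((Fintype.card (Edge 3 L) : ℝ) * (558 * α ^ 2 * (9 * L * R₁ + ε) ^ 2 + 192 * α * (9 * L * R₁ + ε) ^ 2) + 216 * α * δ * (ε * Fintype.card (Site 3 L))) +
            β / 2 * (100 * ((L : ℝ) ^ 3 * (12 * δ ^ 4)) * (Fintype.card (Plaquette 3 L × Fin 3) : ℝ) * R ^ 2 + 10080 * α * (Fintype.card (Plaquette 3 L × Fin 3) : ℝ) * R ^ 2 +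
              (Fintype.card (Plaquette 3 L) : ℝ) * (58752 * t ^ 3 + 1401138 * t ^ 4 + 10000000 * α * t ^ 2))) ^ 2 := ⟨_, rfl⟩
  rw [← hκ₀def]
  have hκ₀0 : 0 ≤ κ₀ := by rw [hκ₀def]; positivity
  have hC0 : 0 ≤ btC L β Ω ε R₁ := by
    unfold btC
    exact div_nonneg (fpBOKernel_nonneg β hΩm hΩ1 hΩ0 (measurable_coreWeight ε R₁) (abs_coreWeight_le ε R₁) (fun g => (coreWeight_mem_Icc ε R₁ g).1) 1 1)
      (transferKernel_pos _ _ _ _).le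
  obtain ⟨τ, hτdef⟩ : ∃ τ : ℝ, τ = Real.exp (6 * ((L : ℝ) ^ 3 * β)) *
        (Real.exp (3 * ((L : ℝ) ^ 3 * β) * α ^ 2) * (Real.exp (-(β * btMnt L δ α R R₁ ε) + β * stepActionErr (L := L) t ((L : ℝ) ^ 3 * (12 * δ ^ 4))) *
              (∫ v, Ω (linkEmbed L v) ∂orthoTransverse L) ^ 2) +
          2 * Real.sqrt (Real.exp (-(β * btMnt L δ α R R₁ ε) + β * stepActionErr (L := L) t ((L : ℝ) ^ 3 * (12 * δ ^ 4))) * (∫ v, Ω (linkEmbed L v) ∂orthoTransverse L) ^ 2) *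
            Real.sqrt (9 * btC L β Ω ε R₁ + Real.exp (-(β * btMnt L δ α R R₁ ε) + β * stepActionErr (L := L) t ((L : ℝ) ^ 3 * (12 * δ ^ 4))) * (∫ v, Ω (linkEmbed L v) ∂orthoTransverse L) ^ 2) +
          Real.exp (-(β * btMfar L δ α R ε P₀)) * (∫ v, Ω (linkEmbed L v) ∂orthoTransverse L) ^ 2 +
          (9 * btC L β Ω ε R₁ + Real.exp (-(β * btMnt L δ α R R₁ ε) + β * stepActionErr (L := L) t ((L : ℝ) ^ 3 * (12 * δ ^ 4))) * (∫ v, Ω (linkEmbed L v) ∂orthoTransverse L) ^ 2) *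
            Real.exp (-((L : ℝ) ^ 3 * β * α ^ 2))) := ⟨_, rfl⟩
  rw [← hτdef] at hτ
  have hτ0 : 0 ≤ τ := by rw [hτdef]; positivity
  -- `btC ≤ a` (core weight ≤ full weight) and the budget in the form `τ/Z ≤ κ₂·a·λ₀/Z`
  have hlam0 : 0 ≤ levelValue su2Rep 1 ((L : ℝ) ^ 3 * β) 0 := levelValue_su2Rep_nonneg 1 hB0 0
  have hCa : btC L β Ω ε R₁ ≤ a := by
    rw [ha]; unfold btC
    refine div_le_div_of_nonneg_right ?_ (transferKernel_pos _ _ _ _).le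
    rw [fpBOKernel_fpWeight_split β ε R₁ hΩm hΩ1 1 1]
    have := fpBOKernel_nonneg β hΩm hΩ1 hΩ0 (measurable_tailWeight ε R₁) (abs_tailWeight_le ε R₁) (fun g => (tailWeight_mem_Icc ε R₁ g).1)
      (1 : GaugeConfig 3 1 SU2) 1
    linarith
  have hθ : τ / fpZ ε ≤ κ₂ * a * levelValue su2Rep 1 ((L : ℝ) ^ 3 * β) 0 / fpZ ε := by
    refine div_le_div_of_nonneg_right (hτ.trans ?_) hZ0.le
    exact mul_le_mul_of_nonneg_right (mul_le_mul_of_nonneg_left hCa hκ₂) hlam0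
  -- the dressing `D = √F`
  obtain ⟨D, hD⟩ : ∃ D : GaugeConfig 3 1 SU2 → ℝ, D = fun u => Real.sqrt (fpBOKernel L β Ω (fpWeight L ε) u u / transferKernel su2Rep ((L : ℝ) ^ 3 * β) u u) := ⟨_, rfl⟩
  have hDu : ∀ u, D u = Real.sqrt (fpBOKernel L β Ω (fpWeight L ε) u u / transferKernel su2Rep ((L : ℝ) ^ 3 * β) u u) := fun u => by rw [hD]
  have hDinv : ∀ (c : SU2) (u : GaugeConfig 3 1 SU2), D (gaugeTransform (fun _ : Site 3 1 => c) u) = D u := fun c u => by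
    rw [hDu, hDu, RateTube.diagRatio_gaugeTransform β hΩm hΩinv hfw (fun c g => fpWeight_conj _ c g) (fun _ : Site 3 1 => c) u]
  -- (1) the symmetric comparison of `…DressedFixedBeta`
  have hpt1 : ∀ w u' : GaugeConfig 3 1 SU2, orbitDist w < δ → orbitDist u' < δ →
      |fpBOKernel L β Ω (fpWeight L ε) w u' - 1 * (D w * D u') * transferKernel su2Rep ((L : ℝ) ^ 3 * β) w u'| ≤ κ₀ * 1 * (D w * D u') * transferKernel su2Rep ((L : ℝ) ^ 3 * β) w u' + τ := by
    intro w u' hw hu'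
    have h := dressed_fixed_beta_estimate_near hβ hΩm hΩ1 hΩ0 hΩinv hΩt hδ2 hα0 hα1 hα30 hε0.le ht0 htT hT hσ hεsum hηd hηs hLa hm₁ hm₂ hP hP0 hJ w u' hw hu'
    rw [← hκ₀def, ← hτdef] at h
    rw [hDu w, hDu u', one_mul, mul_one]
    calc _ ≤ _ := h
      _ = _ := by ring
  -- (2) the colour average
  have hdoor : ∀ u u' : GaugeConfig 3 1 SU2, orbitDist u < δ → orbitDist u' < δ →
      |boKernel L β Ω u u' - 1 / fpZ ε * (D u * D u') * avgKernel ((L : ℝ) ^ 3 * β) u u'| ≤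
        κ₀ * (1 / fpZ ε) * (D u * D u') * avgKernel ((L : ℝ) ^ 3 * β) u u' + τ / fpZ ε :=
    fun u u' hu hu' => boKernel_dressed_pointwise_of_fp_add β ((L : ℝ) ^ 3 * β) hΩm hΩ1 hΩinv hfw hfw1 hZ0 (fpWeight_orbit L ε) hDinv hpt1 u u' hu hu'
  -- (3) the cut-off quotient `V = W/n` on the window and the exchange
  obtain ⟨V, hV⟩ : ∃ V : GaugeConfig 3 1 SU2 → ℝ, V = fun u => if orbitDist u < δ then W u / n u else 0 := ⟨_, rfl⟩
  have hVu : ∀ u, V u = if orbitDist u < δ then W u / n u else 0 := fun u => by rw [hV]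
  have hVm : Measurable V := by
    rw [hV]; exact Measurable.ite (measurableSet_lt measurable_orbitDist measurable_const) (hWm.div hnm) measurable_const
  have hwin' : ∀ u, orbitDist u < δ → 0 < n u ∧ V u = W u / n u ∧ 0 ≤ V u ∧ V u ≤ 2 * CW := by
    intro u hu
    obtain ⟨-, hnmu, -, hm1⟩ := hwin u hu
    obtain ⟨hn0, -⟩ := hn01 u
    have hn_ne : n u ≠ 0 := fun h => by rw [h] at hnmu; norm_num at hnmu
    have hnpos : 0 < n u := lt_of_le_of_ne hn0 (Ne.symm hn_ne)
    have hm32 : m u ≤ 3 / 2 := by have := (abs_le.mp hm1).2; linarith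
    have hn2 : (1 / 2 : ℝ) ^ 2 ≤ n u ^ 2 := by
      have := mul_le_mul_of_nonneg_left hm32 (sq_nonneg (n u)); nlinarith only [this, hnmu]
    have hnhalf : 1 / 2 ≤ n u := (pow_le_pow_iff_left₀ (by norm_num) hn0 two_ne_zero).mp hn2
    have hVe : V u = W u / n u := by rw [hVu, if_pos hu]
    have hWle : W u ≤ CW := (le_abs_self _).trans (hWC u)
    refine ⟨hnpos, hVe, by rw [hVe]; exact div_nonneg (hW0 u) hn0, ?_⟩
    rw [hVe, div_le_iff₀ hnpos]
    have := mul_le_mul_of_nonneg_left hnhalf (by positivity : (0 : ℝ) ≤ 2 * CW)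
    linarith
  have hCV : ∀ u, |V u| ≤ 2 * CW := fun u => by
    by_cases hu : orbitDist u < δ
    · obtain ⟨-, -, h0, h2⟩ := hwin' u hu; rw [abs_of_nonneg h0]; exact h2
    · rw [hVu, if_neg hu, abs_zero]; positivity
  have hVg : ∀ (g : Site 3 1 → SU2) (u : GaugeConfig 3 1 SU2), V (gaugeTransform g u) = V u := fun g u => by
    rw [hVu, hVu, orbitDist_gaugeTransform, hWphys.gaugeInv, hng]
  have hnV : ∀ u, orbitDist u < δ → n u * V u = W u := fun u hu => by
    obtain ⟨hn, hVe, -, -⟩ := hwin' u hu; rw [hVe]; field_simp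
  have hpt2 : ∀ u u' : GaugeConfig 3 1 SU2, orbitDist u < δ → orbitDist u' < δ →
      |boKernel L β Ω u u' - a / 2 / fpZ ε * (V u * V u') * avgKernel ((L : ℝ) ^ 3 * β) u u'| ≤
        (κ₀ * (1 + 5 * εW) + 5 * εW) * (a / 2 / fpZ ε) * (|V u| * |V u'|) * avgKernel ((L : ℝ) ^ 3 * β) u u' + τ / fpZ ε := by
    intro u u' hu hu'
    obtain ⟨hnu, hVe, hV0, -⟩ := hwin' u hu
    obtain ⟨hnu', hVe', hV0', -⟩ := hwin' u' hu'
    obtain ⟨hWu, hnmu, hW1u, -⟩ := hwin u hu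
    obtain ⟨hWu', hnmu', hW1u', -⟩ := hwin u' hu'
    have hW2u : 1 / 2 ≤ W u ^ 2 := by have := (abs_le.mp hW1u).1; linarith
    have hW2u' : 1 / 2 ≤ W u' ^ 2 := by have := (abs_le.mp hW1u').1; linarith
    obtain ⟨r, hr, hDr⟩ := sqrt_dressing_exchange ha_pos (hF0 u) hnu hnmu (hW0 u) hW2u hWu
    obtain ⟨r', hr', hDr'⟩ := sqrt_dressing_exchange ha_pos (hF0 u') hnu' hnmu' (hW0 u') hW2u' hWu'
    have hD1 : D u = Real.sqrt (a / 2) * V u * (1 + r) := by rw [hDu, hDr, hVe]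
    have hD2 : D u' = Real.sqrt (a / 2) * V u' * (1 + r') := by rw [hDu, hDr', hVe']
    have h := kernel_exchange_pointwise (avgKernel_pos _ u u').le hZ0 ha_pos.le hV0 hV0' hκ₀0 hεW0 hεW4 hr hr' hD1 hD2 (hdoor u u' hu hu')
    rw [abs_of_nonneg hV0, abs_of_nonneg hV0']; exact h
  -- (4) the near/far reduction with the normaliser
  have hc0 : 0 ≤ a / 2 / fpZ ε := by positivity
  have hκ₁0 : 0 ≤ κ₀ * (1 + 5 * εW) + 5 * εW := by positivity
  have hθ0 : 0 ≤ τ / fpZ ε := by positivity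
  have hδ' : δ < 2 := by linarith
  have hn1 : ∀ u, |n u| ≤ 1 := fun u => by obtain ⟨h0, h1⟩ := hn01 u; rw [abs_of_nonneg h0]; exact h1
  have hmain := RateTube.tubeForm_boFunAd_normalised_near_of_nearFar β hB0 hΩm hΩ1 hc0 hκ₁0 hθ0 hδ' hnm hn1 hng hVm hCV hVg hnV hpt2 hφm hCφ hφg hsupp
  -- (5) bookkeeping: `‖φW‖² ≤ C_W²‖φ‖²`, the budget, nonnegativity
  have hlW := l2_mul_sq_le hφm hCφ hWm hWC
  have hq0 : 0 ≤ qform su2Rep ((L : ℝ) ^ 3 * β) (fun u => φ u * W u) (fun u => φ u * W u) :=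
    qform_self_nonneg_of_bounded hB0 (hφm.mul hWm) (C := Cφ * CW) fun u => by rw [abs_mul]; exact mul_le_mul (hCφ u) (hWC u) (abs_nonneg _) hCφ0
  have hl0 : 0 ≤ l2 φ φ := l2_self_nonneg φ
  obtain ⟨q, hq⟩ : ∃ q : ℝ, q = qform su2Rep ((L : ℝ) ^ 3 * β) (fun u => φ u * W u) (fun u => φ u * W u) := ⟨_, rfl⟩
  obtain ⟨lam, hlam⟩ : ∃ lam : ℝ, lam = levelValue su2Rep 1 ((L : ℝ) ^ 3 * β) 0 := ⟨_, rfl⟩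
  obtain ⟨c, hc⟩ : ∃ c : ℝ, c = a / 2 / fpZ ε := ⟨_, rfl⟩
  rw [← hq, ← hlam, ← hc] at hmain ⊢
  rw [← hq] at hq0
  rw [← hlam] at hlam0 hθ
  rw [← hc] at hc0
  have p1 : lam * l2 (fun u => φ u * W u) (fun u => φ u * W u) ≤ lam * (CW ^ 2 * l2 φ φ) := mul_le_mul_of_nonneg_left hlW hlam0
  have p2 : (κ₀ * (1 + 5 * εW) + 5 * εW) * c * (q + lam * l2 (fun u => φ u * W u) (fun u => φ u * W u)) ≤
      (κ₀ * (1 + 5 * εW) + 5 * εW) * c * (q + lam * (CW ^ 2 * l2 φ φ)) := mul_le_mul_of_nonneg_left (by linarith) (mul_nonneg hκ₁0 hc0)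
  have p3 : τ / fpZ ε * l2 φ φ ≤ (κ₂ * a * lam / fpZ ε) * l2 φ φ := mul_le_mul_of_nonneg_right hθ hl0
  have e3 : κ₂ * a * lam / fpZ ε = 2 * κ₂ * c * lam := by rw [hc]; field_simp
  rw [e3] at p3
  have n1 : 0 ≤ (κ₀ * (1 + 5 * εW) + 5 * εW) * CW ^ 2 * (c * q) := by positivity
  have n2 : 0 ≤ κ₂ * (c * q) := by positivity
  have n3 : 0 ≤ (κ₀ * (1 + 5 * εW) + 5 * εW) * (c * (lam * l2 φ φ)) := by positivity
  linarith [hmain, p2, p3, n1, n2, n3]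

end Summit.QuantumFields.YangMills.Theorems.FemtoTransferGap.TwoLattice.ConstTube

end
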